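import Mathlib

/-!
# T5OrderCounting — the order-counting step of Tier-5 sub-step N4.1 (cell pub-hodge-repro2)

Kernel witness (support seat p6; route/T5-CHECK-N41-p6.md §3) for the ELEMENTARY part of the
argument (P2)–(P5) of route/T5-N4.1-route-1.md v2.1 (owner route-1):

* near a point `x` (the point `s = 1`) a meromorphic function `Λ` is written as a product
  `Λ = Z * L₁ * L₂` of meromorphic functions — in the prose `Z = L_S · ∏ P_{i,v}` (the finitely
  many local factors at the places of `S`, zero-free), `L₁ = L_fin(s, η₁′)`, `L₂ = L_fin(s, η₂′)`;
* "zero-free" enters ONLY as `meromorphicOrderAt Z x ≤ 0` (a function whose reciprocal is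
  analytic and not identically zero has order `≤ 0`: `meromorphicOrderAt_inv_le_zero`);
* (P4): if `L₁` has a simple pole (`order = -1`) and `L₂` has order `≤ 0`, then `Λ` has
  negative order, hence a pole — it is not analytic and has no finite limit at `x`
  (`meromorphicOrderAt_neg_of_simple_pole`, `not_analyticAt_of_simple_pole`,
  `not_tendsto_of_simple_pole`); contrapositively, if `Λ` is analytic at `x` then `L₁` has
  order `≥ 0` (`meromorphicOrderAt_nonneg_of_analyticAt`) — "a trivial character would force a
  pole";
* (P5): if `Λ` is analytic at `x` and `L₁`, `L₂` have order `0` (finite non-zero values), then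
  `Z` has order exactly `0` and `Λ` has a non-zero limit, `Λ x ≠ 0`
  (`meromorphicOrderAt_eq_zero_of_analyticAt`, `apply_ne_zero_of_analyticAt`);
* the finite products: a finite product of functions of order `≤ 0` has order `≤ 0`
  (`meromorphicOrderAt_prod_nonpos`), a finite product of analytic functions non-vanishing at `x`
  has order `0` (`meromorphicOrderAt_prod_eq_zero`) — the bracket `∏_{v ∈ S_fin} P_{1,v} P_{2,v}`.

Nothing about L-functions, Hecke characters, or the doubling method is asserted: the inputs
"`Λ` is holomorphic at `1`" (GQT Thm 33(ii)), "`ζ_E` has a simple pole at `1`" and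
"`L(1, η) ≠ 0` for `η ≠ 1`" (Iwasawa Thm 3.1 / Prop. 4.4) are the HYPOTHESES of these lemmas.
Mathlib only; no import of the main tree.
-/

open Filter Topology

namespace Summit.Ventures.HodgeRepro2.T5OrderCounting

variable {𝕜 : Type*} [NontriviallyNormedField 𝕜] {𝕜' : Type*} [NontriviallyNormedField 𝕜']
  [NormedAlgebra 𝕜 𝕜'] {x : 𝕜}

/-- A meromorphic function whose reciprocal is analytic at `x` and not identically zero near `x`
has order `≤ 0` at `x`: this is how "zero-free" (the local `L`-factors `1/P_v(q^{-s})` and the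
`Γ`-factors, whose reciprocals are entire) enters the order counting. -/
theorem meromorphicOrderAt_inv_le_zero {g : 𝕜 → 𝕜'} (hg : AnalyticAt 𝕜 g x)
    (hg' : meromorphicOrderAt g x ≠ ⊤) : meromorphicOrderAt g⁻¹ x ≤ 0 := by
  rw [meromorphicOrderAt_inv]
  have h0 : 0 ≤ meromorphicOrderAt g x := hg.meromorphicOrderAt_nonneg
  lift meromorphicOrderAt g x to ℤ using hg' with a ha
  have : (0 : ℤ) ≤ a := by exact_mod_cast h0
  have hneg : -(a : WithTop ℤ) = ((-a : ℤ) : WithTop ℤ) := by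
    rw [← WithTop.LinearOrderedAddCommGroup.coe_neg]
  rw [hneg]
  exact_mod_cast (neg_nonpos.mpr this)

/-- An analytic function not vanishing at `x` has meromorphic order `0` there. -/
theorem meromorphicOrderAt_eq_zero_of_ne_zero {g : 𝕜 → 𝕜'} (hg : AnalyticAt 𝕜 g x)
    (hg' : g x ≠ 0) : meromorphicOrderAt g x = 0 := by
  rw [← tendsto_ne_zero_iff_meromorphicOrderAt_eq_zero hg.meromorphicAt]
  exact ⟨g x, hg', hg.continuousAt.continuousWithinAt.tendsto⟩

/-- A finite product of meromorphic functions of order `≤ 0` has order `≤ 0`. -/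
theorem meromorphicOrderAt_prod_nonpos {ι : Type*} {s : Finset ι} {f : ι → 𝕜 → 𝕜'}
    (hf : ∀ i ∈ s, MeromorphicAt (f i) x) (h : ∀ i ∈ s, meromorphicOrderAt (f i) x ≤ 0) :
    meromorphicOrderAt (∏ i ∈ s, f i) x ≤ 0 := by
  rw [meromorphicOrderAt_prod hf]
  exact Finset.sum_nonpos h

/-- A finite product of analytic functions, none vanishing at `x`, has order `0` at `x`
(the bracket `∏_{v ∈ S_fin} P_{1,v}(s) P_{2,v}(s)` of (P3), non-zero at `s = 1`). -/
theorem meromorphicOrderAt_prod_eq_zero {ι : Type*} {s : Finset ι} {f : ι → 𝕜 → 𝕜'}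
    (hf : ∀ i ∈ s, AnalyticAt 𝕜 (f i) x) (h : ∀ i ∈ s, f i x ≠ 0) :
    meromorphicOrderAt (∏ i ∈ s, f i) x = 0 := by
  rw [meromorphicOrderAt_prod (fun i hi => (hf i hi).meromorphicAt)]
  exact Finset.sum_eq_zero (fun i hi => meromorphicOrderAt_eq_zero_of_ne_zero (hf i hi) (h i hi))

/-- The order of the triple product `Z * L₁ * L₂` is the sum of the three orders. -/
theorem meromorphicOrderAt_triple {Z L₁ L₂ : 𝕜 → 𝕜'} (hZ : MeromorphicAt Z x)
    (hL₁ : MeromorphicAt L₁ x) (hL₂ : MeromorphicAt L₂ x) :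
    meromorphicOrderAt (Z * L₁ * L₂) x =
      meromorphicOrderAt Z x + meromorphicOrderAt L₁ x + meromorphicOrderAt L₂ x := by
  rw [meromorphicOrderAt_mul (hZ.mul hL₁) hL₂, meromorphicOrderAt_mul hZ hL₁]

/-- (P4), the pole: if `Z` has order `≤ 0`, `L₁` has a simple pole (`order = -1`) and `L₂` has
order `≤ 0`, then `Z * L₁ * L₂` has negative order. In the prose: `η₁′ = 1` gives
`ord_{s=1} L_fin(s, η₁′) = -1` (simple pole of `ζ_E`), `ord L_fin(s, η₂′) ∈ {-1, 0}`, `ord Z ≤ 0`,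
so `ord Λ ≤ -1`. -/
theorem meromorphicOrderAt_neg_of_simple_pole {Z L₁ L₂ : 𝕜 → 𝕜'} (hZ : MeromorphicAt Z x)
    (hL₁ : MeromorphicAt L₁ x) (hL₂ : MeromorphicAt L₂ x)
    (hZ0 : meromorphicOrderAt Z x ≤ 0) (h₁ : meromorphicOrderAt L₁ x = -1)
    (h₂ : meromorphicOrderAt L₂ x ≤ 0) :
    meromorphicOrderAt (Z * L₁ * L₂) x < 0 := by
  rw [meromorphicOrderAt_triple hZ hL₁ hL₂, h₁]
  have hZt : meromorphicOrderAt Z x ≠ ⊤ := ne_top_of_le_ne_top WithTop.zero_ne_top hZ0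
  have hLt : meromorphicOrderAt L₂ x ≠ ⊤ := ne_top_of_le_ne_top WithTop.zero_ne_top h₂
  lift meromorphicOrderAt Z x to ℤ using hZt with a ha
  lift meromorphicOrderAt L₂ x to ℤ using hLt with b hb
  have ha' : a ≤ 0 := by exact_mod_cast hZ0
  have hb' : b ≤ 0 := by exact_mod_cast h₂
  have hm1 : (-1 : WithTop ℤ) = ((-1 : ℤ) : WithTop ℤ) := by norm_cast
  rw [hm1]
  exact_mod_cast (by omega : a + -1 + b < 0)

/-- (P4), contradiction form: a function of negative order at `x` is not analytic at `x`. -/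
theorem not_analyticAt_of_simple_pole {Z L₁ L₂ : 𝕜 → 𝕜'} (hZ : MeromorphicAt Z x)
    (hL₁ : MeromorphicAt L₁ x) (hL₂ : MeromorphicAt L₂ x)
    (hZ0 : meromorphicOrderAt Z x ≤ 0) (h₁ : meromorphicOrderAt L₁ x = -1)
    (h₂ : meromorphicOrderAt L₂ x ≤ 0) :
    ¬ AnalyticAt 𝕜 (Z * L₁ * L₂) x := fun h =>
  absurd h.meromorphicOrderAt_nonneg
    (not_le.mpr (meromorphicOrderAt_neg_of_simple_pole hZ hL₁ hL₂ hZ0 h₁ h₂))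

/-- (P4), limit form: under the same hypotheses the product has no finite limit at `x` — it
tends to infinity (a pole). -/
theorem not_tendsto_of_simple_pole {Z L₁ L₂ : 𝕜 → 𝕜'} (hZ : MeromorphicAt Z x)
    (hL₁ : MeromorphicAt L₁ x) (hL₂ : MeromorphicAt L₂ x)
    (hZ0 : meromorphicOrderAt Z x ≤ 0) (h₁ : meromorphicOrderAt L₁ x = -1)
    (h₂ : meromorphicOrderAt L₂ x ≤ 0) :
    Tendsto (Z * L₁ * L₂) (𝓝[≠] x) (Bornology.cobounded 𝕜') :=
  (tendsto_cobounded_iff_meromorphicOrderAt_neg ((hZ.mul hL₁).mul hL₂)).mpr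
    (meromorphicOrderAt_neg_of_simple_pole hZ hL₁ hL₂ hZ0 h₁ h₂)

/-- (P4), contrapositive as used: if `Z * L₁ * L₂` is analytic at `x` (GQT: `Λ` holomorphic at
`s = 1`), `Z` has order `≤ 0` and `L₂` has order `≤ 0`, then `L₁` has order `≥ 0` — `L₁` has no
pole; in particular `η₁′ ≠ 1`. Symmetrically for `L₂`. -/
theorem meromorphicOrderAt_nonneg_of_analyticAt {Z L₁ L₂ : 𝕜 → 𝕜'} (hZ : MeromorphicAt Z x)
    (hL₁ : MeromorphicAt L₁ x) (hL₂ : MeromorphicAt L₂ x)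
    (hΛ : AnalyticAt 𝕜 (Z * L₁ * L₂) x)
    (hZ0 : meromorphicOrderAt Z x ≤ 0) (h₂ : meromorphicOrderAt L₂ x ≤ 0) :
    0 ≤ meromorphicOrderAt L₁ x := by
  have hsum := hΛ.meromorphicOrderAt_nonneg
  rw [meromorphicOrderAt_triple hZ hL₁ hL₂] at hsum
  by_cases ht : meromorphicOrderAt L₁ x = ⊤
  · rw [ht]; exact le_top
  have hZt : meromorphicOrderAt Z x ≠ ⊤ := ne_top_of_le_ne_top WithTop.zero_ne_top hZ0
  have hLt : meromorphicOrderAt L₂ x ≠ ⊤ := ne_top_of_le_ne_top WithTop.zero_ne_top h₂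
  lift meromorphicOrderAt Z x to ℤ using hZt with a ha
  lift meromorphicOrderAt L₂ x to ℤ using hLt with b hb
  lift meromorphicOrderAt L₁ x to ℤ using ht with c hc
  have ha' : a ≤ 0 := by exact_mod_cast hZ0
  have hb' : b ≤ 0 := by exact_mod_cast h₂
  have hs : (0 : ℤ) ≤ a + c + b := by exact_mod_cast hsum
  exact_mod_cast (by omega : (0 : ℤ) ≤ c)

/-- The symmetric statement for the second factor. -/
theorem meromorphicOrderAt_nonneg_of_analyticAt' {Z L₁ L₂ : 𝕜 → 𝕜'} (hZ : MeromorphicAt Z x)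
    (hL₁ : MeromorphicAt L₁ x) (hL₂ : MeromorphicAt L₂ x)
    (hΛ : AnalyticAt 𝕜 (Z * L₁ * L₂) x)
    (hZ0 : meromorphicOrderAt Z x ≤ 0) (h₁ : meromorphicOrderAt L₁ x ≤ 0) :
    0 ≤ meromorphicOrderAt L₂ x := by
  have h : Z * L₁ * L₂ = Z * L₂ * L₁ := by ring
  rw [h] at hΛ
  exact meromorphicOrderAt_nonneg_of_analyticAt hZ hL₂ hL₁ hΛ hZ0 h₁

/-- (P5), the order of `Z`: if `Z * L₁ * L₂` is analytic at `x`, `Z` has order `≤ 0` and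
`L₁`, `L₂` have order `0`, then `Z` has order exactly `0` — `Z` is holomorphic and non-zero
at `x`. -/
theorem meromorphicOrderAt_eq_zero_of_analyticAt {Z L₁ L₂ : 𝕜 → 𝕜'} (hZ : MeromorphicAt Z x)
    (hL₁ : MeromorphicAt L₁ x) (hL₂ : MeromorphicAt L₂ x)
    (hΛ : AnalyticAt 𝕜 (Z * L₁ * L₂) x) (hZ0 : meromorphicOrderAt Z x ≤ 0)
    (h₁ : meromorphicOrderAt L₁ x = 0) (h₂ : meromorphicOrderAt L₂ x = 0) :
    meromorphicOrderAt Z x = 0 := by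
  have hsum := hΛ.meromorphicOrderAt_nonneg
  rw [meromorphicOrderAt_triple hZ hL₁ hL₂, h₁, h₂, add_zero, add_zero] at hsum
  exact le_antisymm hZ0 hsum

/-- (P5), the non-zero limit: under the hypotheses of the previous lemma, `Z * L₁ * L₂` has
order `0`, i.e. a non-zero limit at `x`. -/
theorem tendsto_ne_zero_of_analyticAt {Z L₁ L₂ : 𝕜 → 𝕜'} (hZ : MeromorphicAt Z x)
    (hL₁ : MeromorphicAt L₁ x) (hL₂ : MeromorphicAt L₂ x)
    (hΛ : AnalyticAt 𝕜 (Z * L₁ * L₂) x) (hZ0 : meromorphicOrderAt Z x ≤ 0)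
    (h₁ : meromorphicOrderAt L₁ x = 0) (h₂ : meromorphicOrderAt L₂ x = 0) :
    ∃ c ≠ 0, Tendsto (Z * L₁ * L₂) (𝓝[≠] x) (𝓝 c) := by
  rw [tendsto_ne_zero_iff_meromorphicOrderAt_eq_zero ((hZ.mul hL₁).mul hL₂),
    meromorphicOrderAt_triple hZ hL₁ hL₂,
    meromorphicOrderAt_eq_zero_of_analyticAt hZ hL₁ hL₂ hΛ hZ0 h₁ h₂, h₁, h₂]
  simp

/-- (P5), the value: `Λ(1) = Z(1) · L_fin(1, η₁′) · L_fin(1, η₂′) ≠ 0`. For an analytic `Λ` equal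
to `Z * L₁ * L₂`, the value `Λ x` is the limit, hence non-zero. -/
theorem apply_ne_zero_of_analyticAt {Λ Z L₁ L₂ : 𝕜 → 𝕜'} (hΛZ : Λ = Z * L₁ * L₂)
    (hZ : MeromorphicAt Z x) (hL₁ : MeromorphicAt L₁ x) (hL₂ : MeromorphicAt L₂ x)
    (hΛ : AnalyticAt 𝕜 Λ x) (hZ0 : meromorphicOrderAt Z x ≤ 0)
    (h₁ : meromorphicOrderAt L₁ x = 0) (h₂ : meromorphicOrderAt L₂ x = 0) : Λ x ≠ 0 := by
  subst hΛZ
  obtain ⟨c, hc, hlim⟩ := tendsto_ne_zero_of_analyticAt hZ hL₁ hL₂ hΛ hZ0 h₁ h₂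
  have hcont := hΛ.continuousAt.continuousWithinAt.tendsto (s := {x}ᶜ)
  rw [tendsto_nhds_unique hlim hcont] at hc
  exact hc

/-- Order `0` of a meromorphic function at `x` from a finite non-zero limit: this is how
"`L(1 + it; χ) ≠ 0` and holomorphic at `1`" (Iwasawa Thm 3.1 + Prop. 4.4 for `χ ≢ 1`) enters —
the order of `L_fin(s, η′)` at `s = 1` is `0` when `η′ ≠ 1`. -/
theorem meromorphicOrderAt_eq_zero_of_tendsto {L : 𝕜 → 𝕜'} (hL : MeromorphicAt L x) {c : 𝕜'}
    (hc : c ≠ 0) (h : Tendsto L (𝓝[≠] x) (𝓝 c)) : meromorphicOrderAt L x = 0 :=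
  (tendsto_ne_zero_iff_meromorphicOrderAt_eq_zero hL).mp ⟨c, hc, h⟩

/-- Order `-1` from the shape of a simple pole: if `L = fun s => (s - x)⁻¹ • g s` near `x` with
`g` analytic and `g x ≠ 0` (the residue), then `L` has order `-1` at `x` — the shape of `ζ_E`
at `s = 1` (Iwasawa Thm 3.1: "a unique simple pole at `s = 1`"); for `𝕜 = 𝕜' = ℂ` the scalar
action is the product `(s - x)⁻¹ * g s`. -/
theorem meromorphicOrderAt_eq_neg_one {L g : 𝕜 → 𝕜'} (hL : MeromorphicAt L x)
    (hg : AnalyticAt 𝕜 g x) (hg0 : g x ≠ 0)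
    (h : L =ᶠ[𝓝[≠] x] fun s => (s - x)⁻¹ • g s) : meromorphicOrderAt L x = -1 := by
  have hpow : (fun s : 𝕜 => (s - x)⁻¹ • g s) = fun s : 𝕜 => (s - x) ^ ((-1 : ℤ)) • g s := by
    funext s; rw [zpow_neg_one]
  rw [hpow] at h
  exact (meromorphicOrderAt_eq_int_iff hL).mpr ⟨g, hg, hg0, h⟩

end Summit.Ventures.HodgeRepro2.T5OrderCounting
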